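import Summits.HodgeConjecture.HodgeConjecture.Theorems.FormalLiftingFromClassLifting.Negative.ProClassCorrectionStubs

/-!
# `FormalLiftingFromClassLifting` (stmt-HodgeConjecture-13825) · glue: the reduction, step class lifting, the two compositions

Crux P1a of route `PadicSemiregularLift`: on a Hodge-torsion-free smooth projective `𝒳/W(k)`
(`d + 6 < p`, `d ≤ 3 ∨ Ω¹` free), a finite locally free `E₁` on `X_k` with (⋆)
CLASS-LIFTS-IMPLY-OBJECT-LIFTS and a RATIONAL pro-class `ξ ∈ (lim_n K₀(X_n)) ⊗ ℚ` under `[E₁] ⊗ 1`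
lifts formally (`WittScheme.LiftsFormally`).

This file lands, sorry-free and over tree vocabulary only (no
definitions: every statement is spelled out over `KTheory.KZero`, `WittScheme.thickening`,
`specialFibreToThickening`, `thickeningMap`), the GLUE of line `pro-class-correction-syntomic` of the
crux — everything except its three registered stubs S1 `stub_kernelTowerSurjective` (= (2_K)
kernel-tower surjectivity), S2 `stub_pSaturation`, S3 `stub_primeToPLifting`. Here:

* (level `0` of every stub is free because `X_k ⟶ X_1 = 𝒳 ⊗ W/p` is an isomorphism for `k`
  perfect — landed by the standing disprover as `Negative.isIso_specialFibreToThickening_zero'`,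
  `Negative.exists_lift_level_zero`, `Negative.kernelTowerSurjective_level_zero` in
  `Theorems/…/Negative/ProClassCorrectionStubs.lean`, imported here, together with clearing of
  denominators `Negative.exists_int_multiple_lifts_all_levels` and
  `Negative.exists_lift_all_levels_of_stubs`);
* `liftsFormally_of_stepClassLifting` — the REDUCTION: on any `W(k)`-scheme, (⋆) + "every
  finite-level finite locally free lift `F` of `E₁` has `[F] ∈ im(K₀(X_{n+2}) → K₀(X_{n+1}))`"
  ⇒ `LiftsFormally 𝒳 E₁` (credit: the standing disprover, refuter-cdisprove-stmt-HodgeConjecture-13825-0,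
  `Cruxes/FormalLiftingFromClassLifting/Disproof.lean` cycle 1, whose `Stage`/`tower` recursion is
  inlined here as a `Nat.rec` on a subtype so that the file declares theorems only);
* `stepClassLifting_of_levelwiseLifts_of_kernelTower` — level-wise integral lifts of `[E₁]` + (2_K)
  ⇒ that premise; `stepClassLifting_of_compatibleLift_of_kernelTower` — the same from an integral
  COMPATIBLE family ((1_K) of the disprover's suggested split);
* `glue_formalLiftingFromClassLifting_of_oneK_twoK` — the COMPOSITION a planner split can cite
  (`route edit --split … --glue-by`): (1_K) "under the hypotheses of the crux, a rationally
  pro-liftable `[E₁]` has an INTEGRAL compatible lift in `lim_n K₀(X_{n+1})`" → (2_K) "under the same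
  hypotheses the kernel tower `ker(K₀(X_{n+2}) → K₀(X_k)) → ker(K₀(X_{n+1}) → K₀(X_k))` is onto" →
  `FormalLiftingFromClassLifting` (the disprover's `crux_of_oneK_twoK`, now importable; registered as
  a sub-goal of the skeleton so that it can land `--supports`);
* `glue_formalLiftingFromClassLifting_of_stubs` — the skeleton's own composition S1 → S2 → S3 →
  `FormalLiftingFromClassLifting` (registered stub signatures verbatim as hypotheses), via
  `Negative.exists_lift_all_levels_of_stubs` + `stepClassLifting_of_levelwiseLifts_of_kernelTower` +
  the reduction (also registered as a sub-goal).

Nothing here uses smoothness, properness, projectivity, a bound on `p` or torsion-freeness.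
-/

-- `Summit.HodgeConjecture.HodgeConjecture.…` repeats the summit name by the D-0017 layout (Sub = Summit).
set_option linter.dupNamespace false

namespace Summit.HodgeConjecture.HodgeConjecture.Theorems.FormalLiftingFromClassLifting.Glue

open CategoryTheory AlgebraicGeometry Limits
open Literature.AlgebraicGeometry Literature.AlgebraicGeometry.Motives
open Literature.AlgebraicGeometry.Motives.WittScheme
open Summit.HodgeConjecture.HodgeConjecture.Theses.PadicSemiregularLift
open Summit.HodgeConjecture.HodgeConjecture.Theorems.FormalLiftingFromClassLifting.Negative
  (specialFibreToThickening_comp_thickeningMap isIso_specialFibreToThickening_zero'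
    exists_lift_all_levels_of_stubs)

noncomputable section

/-! ## 1. The reduction: (⋆) + step class lifting ⇒ `LiftsFormally` -/

section Reduction

variable {p : ℕ} [Fact p.Prime] {k : Type} [Field k] [CharP k p] [PerfectRing k p]
  {𝒳 : SchemeOver (WittVector p k)} {E₁ : (specialFibre 𝒳).left.Modules}

/-- **REDUCTION** (credit: refuter-cdisprove-stmt-HodgeConjecture-13825-0, `Disproof.lean`
`liftsFormally_of_integralStepClassLifting`). On ANY `W(k)`-scheme `𝒳` (`k` perfect of
characteristic `p`), a finite locally free `E₁` on the special fibre satisfying hypothesis (⋆)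
CLASS-LIFTS-IMPLY-OBJECT-LIFTS of the crux (`hstar`, verbatim) and STEP CLASS LIFTING (`hstep`: every
finite-level finite locally free lift `F` of `E₁` to `X_{n+1}` has `[F] ∈ im(K₀(X_{n+2}) → K₀(X_{n+1}))`)
lifts formally: start from `E₁` transported to `X_1 ≅ X_k` and climb with (⋆), by recursion on the
level over the type of finite locally free lifts of `E₁`. No smoothness, properness, projectivity,
bound on `p` or torsion-freeness is used. [folklore] -/
theorem liftsFormally_of_stepClassLifting (hE₁ : IsFiniteLocallyFree E₁)
    (hstar : ∀ (n : ℕ) (F : (thickening 𝒳 (n + 1)).left.Modules) (hF : IsFiniteLocallyFree F),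
      Nonempty ((Scheme.Modules.pullback (specialFibreToThickening 𝒳 n)).obj F ≅ E₁) →
      (∃ y : KTheory.KZero (thickening 𝒳 (n + 2)).left,
        KTheory.KZero.map (thickeningMap 𝒳 (Nat.le_succ (n + 1))) y = KTheory.KZero.of F hF) →
      ∃ F' : (thickening 𝒳 (n + 2)).left.Modules, IsFiniteLocallyFree F' ∧
        Nonempty ((Scheme.Modules.pullback (thickeningMap 𝒳 (Nat.le_succ (n + 1)))).obj F' ≅ F))
    (hstep : ∀ (n : ℕ) (F : (thickening 𝒳 (n + 1)).left.Modules) (hF : IsFiniteLocallyFree F),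
      Nonempty ((Scheme.Modules.pullback (specialFibreToThickening 𝒳 n)).obj F ≅ E₁) →
      ∃ y : KTheory.KZero (thickening 𝒳 (n + 2)).left,
        KTheory.KZero.map (thickeningMap 𝒳 (Nat.le_succ (n + 1))) y = KTheory.KZero.of F hF) :
    LiftsFormally 𝒳 E₁ := by
  classical
  have := isIso_specialFibreToThickening_zero' 𝒳
  -- the type of stages at level `n`: finite locally free lifts of `E₁` to `X_{n+1}`
  let T : ℕ → Type 1 := fun n => {F : (thickening 𝒳 (n + 1)).left.Modules //
    IsFiniteLocallyFree F ∧
      Nonempty ((Scheme.Modules.pullback (specialFibreToThickening 𝒳 n)).obj F ≅ E₁)}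
  -- the existential used to climb one level
  have hex : ∀ (n : ℕ) (S : T n), ∃ F' : (thickening 𝒳 (n + 2)).left.Modules,
      IsFiniteLocallyFree F' ∧
        Nonempty ((Scheme.Modules.pullback (thickeningMap 𝒳 (Nat.le_succ (n + 1)))).obj F' ≅ S.1) :=
    fun n S => hstar n S.1 S.2.1 S.2.2 (hstep n S.1 S.2.1 S.2.2)
  -- one step up (a choice), with its restriction to `X_k` computed through `X_{n+1}`
  let step : ∀ n : ℕ, T n → T (n + 1) := fun n S =>
    ⟨Classical.choose (hex n S), (Classical.choose_spec (hex n S)).1, by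
      obtain ⟨i⟩ := (Classical.choose_spec (hex n S)).2
      obtain ⟨j⟩ := S.2.2
      refine ⟨?_ ≪≫ j⟩
      refine eqToIso (congrArg (fun f => (Scheme.Modules.pullback f).obj _)
          (specialFibreToThickening_comp_thickeningMap 𝒳 (Nat.le_succ (n + 1))).symm) ≪≫ ?_
      exact ((Scheme.Modules.pullbackComp (specialFibreToThickening 𝒳 n)
          (thickeningMap 𝒳 (Nat.le_succ (n + 1)))).app _).symm ≪≫
        (Scheme.Modules.pullback (specialFibreToThickening 𝒳 n)).mapIso i⟩
  -- stage `0`: transport `E₁` along `e : X_k ≅ X_1`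
  let e := asIso (specialFibreToThickening 𝒳 0)
  let S₀ : T 0 := ⟨(Scheme.Modules.pullback e.inv).obj E₁, hE₁.pullback e.inv,
    ⟨(Scheme.Modules.pullbackComp e.hom e.inv).app E₁ ≪≫
      eqToIso (congrArg (fun f => (Scheme.Modules.pullback f).obj E₁) e.hom_inv_id) ≪≫
      (Scheme.Modules.pullbackId _).app E₁⟩⟩
  -- the tower
  let E : ∀ n : ℕ, T n := fun n => Nat.rec (motive := fun n => T n) S₀ (fun n S => step n S) n
  refine ⟨fun n => (E n).1, fun n => (E n).2.1.isVectorBundle, fun n => ?_, S₀.2.2⟩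
  exact (Classical.choose_spec (hex n (E n))).2

end Reduction

/-! ## 2. Step class lifting from level-wise (or compatible) lifts of `[E₁]` + (2_K) -/

section StepLifting

variable {p : ℕ} [Fact p.Prime] {k : Type} [Field k] [CharP k p]
  {𝒳 : SchemeOver (WittVector p k)}

/-- **Level-wise lifts + (2_K) ⇒ step class lifting.** If `[E₁]` lifts to `K₀(X_{n+1})` for every
`n` (no compatibility asked, `hl`) and the kernel tower of `𝒳` is surjective (`hk`: every class on
`X_{n+1}` dying on `X_k` is the restriction of a class on `X_{n+2}` dying on `X_k`), then every
finite locally free lift `F` of `E₁` to `X_{n+1}` has `[F] ∈ im(K₀(X_{n+2}) → K₀(X_{n+1}))`: pick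
`z ∈ K₀(X_{n+2})` over `[E₁]`; `z|X_{n+1} − [F]` dies on `X_k`, so it is `t'|X_{n+1}` by (2_K), and
`z − t'` restricts to `[F]`. [folklore] -/
theorem stepClassLifting_of_levelwiseLifts_of_kernelTower
    {E₁ : (specialFibre 𝒳).left.Modules} (hE₁ : IsFiniteLocallyFree E₁)
    (hl : ∀ n : ℕ, ∃ z : KTheory.KZero (thickening 𝒳 (n + 1)).left,
      KTheory.KZero.map (specialFibreToThickening 𝒳 n) z = KTheory.KZero.of E₁ hE₁)
    (hk : ∀ (n : ℕ) (t : KTheory.KZero (thickening 𝒳 (n + 1)).left),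
      KTheory.KZero.map (specialFibreToThickening 𝒳 n) t = 0 →
      ∃ t' : KTheory.KZero (thickening 𝒳 (n + 2)).left,
        KTheory.KZero.map (specialFibreToThickening 𝒳 (n + 1)) t' = 0 ∧
        KTheory.KZero.map (thickeningMap 𝒳 (Nat.le_succ (n + 1))) t' = t)
    (n : ℕ) (F : (thickening 𝒳 (n + 1)).left.Modules) (hF : IsFiniteLocallyFree F)
    (hi : Nonempty ((Scheme.Modules.pullback (specialFibreToThickening 𝒳 n)).obj F ≅ E₁)) :
    ∃ y : KTheory.KZero (thickening 𝒳 (n + 2)).left,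
      KTheory.KZero.map (thickeningMap 𝒳 (Nat.le_succ (n + 1))) y = KTheory.KZero.of F hF := by
  obtain ⟨i⟩ := hi
  have hF0 : KTheory.KZero.map (specialFibreToThickening 𝒳 n) (KTheory.KZero.of F hF) =
      KTheory.KZero.of E₁ hE₁ := by
    rw [KTheory.KZero.map_of]
    exact KTheory.KZero.of_iso i _ _
  obtain ⟨z, hz⟩ := hl (n + 1)
  obtain ⟨t', -, ht'⟩ := hk n
    (KTheory.KZero.map (thickeningMap 𝒳 (Nat.le_succ (n + 1))) z - KTheory.KZero.of F hF) (by
      rw [map_sub, hF0, ← KTheory.KZero.map_comp_apply,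
        specialFibreToThickening_comp_thickeningMap 𝒳 (Nat.le_succ (n + 1)), hz, sub_self])
  exact ⟨z - t', by rw [map_sub, ht', sub_sub_cancel]⟩

/-- A compatible family `x_n ∈ K₀(X_{n+1})` restricts on `X_k` to the restriction of its bottom
member. [folklore] -/
theorem map_specialFibreToThickening_of_compatible
    (x : ∀ n : ℕ, KTheory.KZero (thickening 𝒳 (n + 1)).left)
    (hx : ∀ n, KTheory.KZero.map (thickeningMap 𝒳 (Nat.le_succ (n + 1))) (x (n + 1)) = x n)
    (n : ℕ) :
    KTheory.KZero.map (specialFibreToThickening 𝒳 n) (x n) =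
      KTheory.KZero.map (specialFibreToThickening 𝒳 0) (x 0) := by
  induction n with
  | zero => rfl
  | succ n ih =>
    rw [← specialFibreToThickening_comp_thickeningMap 𝒳 (Nat.le_succ (n + 1)),
      KTheory.KZero.map_comp_apply, hx n, ih]

/-- **(1_K) ∧ (2_K) ⇒ step class lifting** (credit: `Disproof.lean`
`integralStepClassLifting_of_compatibleLift_of_kernelTowerSurjective`): an INTEGRAL compatible
family through `[E₁]` and kernel-tower surjectivity give the premise of (⋆) for every finite-level
lift of `E₁`. [folklore] -/
theorem stepClassLifting_of_compatibleLift_of_kernelTower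
    {E₁ : (specialFibre 𝒳).left.Modules} (hE₁ : IsFiniteLocallyFree E₁)
    (h₁ : ∃ x : ∀ n : ℕ, KTheory.KZero (thickening 𝒳 (n + 1)).left,
      (∀ n, KTheory.KZero.map (thickeningMap 𝒳 (Nat.le_succ (n + 1))) (x (n + 1)) = x n) ∧
      KTheory.KZero.map (specialFibreToThickening 𝒳 0) (x 0) = KTheory.KZero.of E₁ hE₁)
    (hk : ∀ (n : ℕ) (t : KTheory.KZero (thickening 𝒳 (n + 1)).left),
      KTheory.KZero.map (specialFibreToThickening 𝒳 n) t = 0 →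
      ∃ t' : KTheory.KZero (thickening 𝒳 (n + 2)).left,
        KTheory.KZero.map (specialFibreToThickening 𝒳 (n + 1)) t' = 0 ∧
        KTheory.KZero.map (thickeningMap 𝒳 (Nat.le_succ (n + 1))) t' = t)
    (n : ℕ) (F : (thickening 𝒳 (n + 1)).left.Modules) (hF : IsFiniteLocallyFree F)
    (hi : Nonempty ((Scheme.Modules.pullback (specialFibreToThickening 𝒳 n)).obj F ≅ E₁)) :
    ∃ y : KTheory.KZero (thickening 𝒳 (n + 2)).left,
      KTheory.KZero.map (thickeningMap 𝒳 (Nat.le_succ (n + 1))) y = KTheory.KZero.of F hF := by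
  obtain ⟨x, hx, hx0⟩ := h₁
  exact stepClassLifting_of_levelwiseLifts_of_kernelTower hE₁
    (fun m => ⟨x m, by rw [map_specialFibreToThickening_of_compatible x hx m, hx0]⟩) hk n F hF hi

end StepLifting


/-! ## 3. The two compositions -/

section Composition

/-- **The crux from the disprover's suggested split** (`Disproof.lean` `crux_of_oneK_twoK`, cycle 1;
registered sub-goal `glue_formalLiftingFromClassLifting_of_oneK_twoK` of the line's skeleton):
(1_K) "under the hypotheses of the crux on `𝒳`, every finite locally free `E₁` on `X_k` whose rational
class pro-lifts (Bloch–Esnault–Kerz Thm 1.3 (b), verbatim the crux's hypothesis) has an INTEGRAL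
compatible lift `(x_n)_n`, `x_n ∈ K₀(X_{n+1})`, `x_{n+1}|X_{n+1} = x_n`, `x_0|X_k = [E₁]`" and
(2_K) "under the same hypotheses every class on `X_{n+1}` dying on `X_k` is the restriction of a class
on `X_{n+2}` dying on `X_k`" together imply `FormalLiftingFromClassLifting`: (1_K) ∧ (2_K) give step
class lifting (`stepClassLifting_of_compatibleLift_of_kernelTower`) and (⋆) climbs the tower
(`liftsFormally_of_stepClassLifting`). Both hypotheses speak about integral `K₀` of the finite
thickenings only (no objects, no (⋆), no `ℚ`). [folklore] -/
theorem glue_formalLiftingFromClassLifting_of_oneK_twoK :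
    (∀ (p : ℕ) [Fact p.Prime] (k : Type) [Field k] [CharP k p] [PerfectRing k p] (d : ℕ)
      (𝒳 : SchemeOver (WittVector p k)),
      IsSmoothProperModel d 𝒳 → Crystalline.IsProjectiveOverRing 𝒳 → d + 6 < p →
      (∀ (b : ℕ) (x : structureSheafCohomology 𝒳.left b), (p : ℤ) • x = 0 → x = 0) →
      (∀ (b : ℕ) (x : hodgeCohomologyOne 𝒳 b), (p : ℤ) • x = 0 → x = 0) →
      (d ≤ 3 ∨ Nonempty (cotangentSheaf 𝒳 ≅
        SheafOfModules.free (R := 𝒳.left.ringCatSheaf) (Fin d))) →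
      ∀ (E₁ : (specialFibre 𝒳).left.Modules) (hE₁ : IsFiniteLocallyFree E₁),
        (∃ ξ : KTheory.ContinuousKZeroRat (Ideal.span {(p : WittVector p k)}) 𝒳,
          KTheory.KZeroRat.map (Crystalline.specialFibreToTower 𝒳)
            (KTheory.ContinuousKZeroRat.specialFibre (Ideal.span {(p : WittVector p k)}) 𝒳 ξ) =
            KTheory.KZeroRat.of E₁ hE₁) →
        ∃ x : ∀ n : ℕ, KTheory.KZero (thickening 𝒳 (n + 1)).left,
          (∀ n, KTheory.KZero.map (thickeningMap 𝒳 (Nat.le_succ (n + 1))) (x (n + 1)) = x n) ∧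
          KTheory.KZero.map (specialFibreToThickening 𝒳 0) (x 0) = KTheory.KZero.of E₁ hE₁) →
    (∀ (p : ℕ) [Fact p.Prime] (k : Type) [Field k] [CharP k p] [PerfectRing k p] (d : ℕ)
      (𝒳 : SchemeOver (WittVector p k)),
      IsSmoothProperModel d 𝒳 → Crystalline.IsProjectiveOverRing 𝒳 → d + 6 < p →
      (∀ (b : ℕ) (x : structureSheafCohomology 𝒳.left b), (p : ℤ) • x = 0 → x = 0) →
      (∀ (b : ℕ) (x : hodgeCohomologyOne 𝒳 b), (p : ℤ) • x = 0 → x = 0) →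
      (d ≤ 3 ∨ Nonempty (cotangentSheaf 𝒳 ≅
        SheafOfModules.free (R := 𝒳.left.ringCatSheaf) (Fin d))) →
      ∀ (n : ℕ) (t : KTheory.KZero (thickening 𝒳 (n + 1)).left),
        KTheory.KZero.map (specialFibreToThickening 𝒳 n) t = 0 →
        ∃ t' : KTheory.KZero (thickening 𝒳 (n + 2)).left,
          KTheory.KZero.map (specialFibreToThickening 𝒳 (n + 1)) t' = 0 ∧
          KTheory.KZero.map (thickeningMap 𝒳 (Nat.le_succ (n + 1))) t' = t) →
    FormalLiftingFromClassLifting := by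
  intro oneK twoK p _ k _ _ _ d 𝒳 h𝒳 hproj hp hO hΩ hd E₁ hE₁ hstar hξ
  exact liftsFormally_of_stepClassLifting hE₁ hstar
    (stepClassLifting_of_compatibleLift_of_kernelTower hE₁
      (oneK p k d 𝒳 h𝒳 hproj hp hO hΩ hd E₁ hE₁ hξ) (twoK p k d 𝒳 h𝒳 hproj hp hO hΩ hd))

/-- **The crux from the three registered stubs of line `pro-class-correction-syntomic`** (their
signatures verbatim as hypotheses, in the order S1 kernel-tower surjectivity (2_K), S2 `p`-saturation
of the pro-image, S3 prime-to-`p` divisibility of the level-wise images; registered sub-goal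
`glue_formalLiftingFromClassLifting_of_stubs`): clearing denominators + S2 + S3 put `[E₁]` in the image
of every `K₀(X_{n+1}) → K₀(X_k)` (`Negative.exists_lift_all_levels_of_stubs`), S1 turns these
level-wise lifts into step class lifting for every finite-level lift `F` of `E₁`
(`stepClassLifting_of_levelwiseLifts_of_kernelTower`), and (⋆) climbs the tower
(`liftsFormally_of_stepClassLifting`). [folklore] -/
theorem glue_formalLiftingFromClassLifting_of_stubs :
    (∀ (p : ℕ) [Fact p.Prime] (k : Type) [Field k] [CharP k p] [PerfectRing k p] (d : ℕ)
      (𝒳 : SchemeOver (WittVector p k)),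
      IsSmoothProperModel d 𝒳 → Crystalline.IsProjectiveOverRing 𝒳 → d + 6 < p →
      (∀ (b : ℕ) (x : structureSheafCohomology 𝒳.left b), (p : ℤ) • x = 0 → x = 0) →
      (∀ (b : ℕ) (x : hodgeCohomologyOne 𝒳 b), (p : ℤ) • x = 0 → x = 0) →
      (d ≤ 3 ∨ Nonempty (cotangentSheaf 𝒳 ≅
        SheafOfModules.free (R := 𝒳.left.ringCatSheaf) (Fin d))) →
      ∀ (n : ℕ) (t : KTheory.KZero (thickening 𝒳 (n + 1)).left),
        KTheory.KZero.map (specialFibreToThickening 𝒳 n) t = 0 →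
        ∃ t' : KTheory.KZero (thickening 𝒳 (n + 2)).left,
          KTheory.KZero.map (specialFibreToThickening 𝒳 (n + 1)) t' = 0 ∧
          KTheory.KZero.map (thickeningMap 𝒳 (Nat.le_succ (n + 1))) t' = t) →
    (∀ (p : ℕ) [Fact p.Prime] (k : Type) [Field k] [CharP k p] [PerfectRing k p] (d : ℕ)
      (𝒳 : SchemeOver (WittVector p k)),
      IsSmoothProperModel d 𝒳 → Crystalline.IsProjectiveOverRing 𝒳 → d + 6 < p →
      (∀ (b : ℕ) (x : structureSheafCohomology 𝒳.left b), (p : ℤ) • x = 0 → x = 0) →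
      (∀ (b : ℕ) (x : hodgeCohomologyOne 𝒳 b), (p : ℤ) • x = 0 → x = 0) →
      (d ≤ 3 ∨ Nonempty (cotangentSheaf 𝒳 ≅
        SheafOfModules.free (R := 𝒳.left.ringCatSheaf) (Fin d))) →
      ∀ y : KTheory.KZero (specialFibre 𝒳).left,
        (∀ n : ℕ, ∃ z : KTheory.KZero (thickening 𝒳 (n + 1)).left,
          KTheory.KZero.map (specialFibreToThickening 𝒳 n) z = (p : ℤ) • y) →
        ∀ n : ℕ, ∃ z : KTheory.KZero (thickening 𝒳 (n + 1)).left,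
          KTheory.KZero.map (specialFibreToThickening 𝒳 n) z = y) →
    (∀ (p : ℕ) [Fact p.Prime] (k : Type) [Field k] [CharP k p] [PerfectRing k p] (d : ℕ)
      (𝒳 : SchemeOver (WittVector p k)),
      IsSmoothProperModel d 𝒳 → Crystalline.IsProjectiveOverRing 𝒳 →
      ∀ (n M : ℕ), ¬ p ∣ M → ∀ y : KTheory.KZero (specialFibre 𝒳).left,
        (∃ z : KTheory.KZero (thickening 𝒳 (n + 1)).left,
          KTheory.KZero.map (specialFibreToThickening 𝒳 n) z = (M : ℤ) • y) →
        ∃ z : KTheory.KZero (thickening 𝒳 (n + 1)).left,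
          KTheory.KZero.map (specialFibreToThickening 𝒳 n) z = y) →
    FormalLiftingFromClassLifting := by
  intro S1 S2 S3 p _ k _ _ _ d 𝒳 h𝒳 hproj hp hO hΩ hd E₁ hE₁ hstar hξ
  exact liftsFormally_of_stepClassLifting hE₁ hstar
    (stepClassLifting_of_levelwiseLifts_of_kernelTower hE₁
      (exists_lift_all_levels_of_stubs (S2 p k d 𝒳 h𝒳 hproj hp hO hΩ hd) (S3 p k d 𝒳 h𝒳 hproj)
        hE₁ hξ)
      (S1 p k d 𝒳 h𝒳 hproj hp hO hΩ hd))

end Composition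

end

end Summit.HodgeConjecture.HodgeConjecture.Theorems.FormalLiftingFromClassLifting.Glue
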